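import Literature.Probability.LatticeModels.DoubleCurrentsProofs
import HarnessLib

/-!
# ADS15 Lemma 2.6 in finite volume: box insertion tolerance of the double current, uniformly in the volume

Trunk G02 (T-STATMECH), topic `Probability/LatticeModels`, namespace `Literature.StatMech`.
Theorem-only file. For the box double currents `ℙ_{Λ_L,β} = adsDoubleCurrentLaw d L β` of
`DoubleCurrents.lean` we prove the finite-volume statement inside the proof of

* M. Aizenman, H. Duminil-Copin, V. Sidoravicius, *Random currents and continuity of Ising
  model's spontaneous magnetization*, Comm. Math. Phys. **334** (2015) 719–742, **Lemma 2.6**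
  (arXiv:1311.1937v3 numbering): "Let `Φ̂_N` be the map opening all edges `{x,y}` in `Λ_N` with
  `J_{x,y} > 0`. … This reduces the proof to showing the existence of `c = c(N,J,β) > 0` on
  `Λ_n`, with a value which does not depend on `n > N`",

in preimage form: **for every `N` there is `c > 0` such that for all `L ≥ N` and all measurable
events `E`, `c · ℙ_{Λ_L,β}{ω : ω ∪ E(Λ_N) ∈ E} ≤ ℙ_{Λ_L,β}(E)`**
(`adsDoubleCurrentLaw_box_insertion`), with the printed mechanism: on a pair of currents
`(n₁, n₂)` change the plus current from `0` to `2` on those bonds of `Λ_N` which carry no current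
at all ("`Φ_N(n₁,n₂){x,y} = (0,2)` if `(n₁{x,y}, n₂{x,y}) = (0,0)`", `insertPair`); this keeps the
sources (`sources_insertPlus`), multiplies the weight by `(β²/2)^{#modified bonds}`
(`weight_insertPlus`), maps the trace to `trace ∪ E(Λ_N)` (`liftBonds_insertPair`), and is at most
`2^{|E(Λ_N)|}`-to-one ("the number of pre-images of each configuration is smaller than `2` to the
power the number of pairs of points in `Λ_N`", `insertPair_injective`), whence the bound with
`c = (2 · max(1, 2/β²))^{-|E(Λ_N)|}`.

This is hypothesis (I) of `ads_exitProb_tendsto_zero_of_finiteVolume`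
(`DoubleCurrentsPercolation.lean`).

## Mathlib status

Anchors: `ENNReal.tsum_comp_le_tsum_of_injective`, `ENNReal.tsum_prod`, `ENNReal.tsum_mul_left`,
`Measure.sum_apply_of_countable`, `Finset.prod_mul_prod_compl`, `Finset.sum_boole`; tree:
`Current`, `Current.weight`, `Current.sources`, `Current.traced`, `adsPairWeight`, `adsPairNorm`,
`liftBonds`, `adsDoubleCurrentLaw`, `freeBoxGraph`, `plusBoxGraph`, `edgesIn`.
-/

noncomputable section

open MeasureTheory Filter Finset
open scoped ENNReal

namespace Literature.Probability.LatticeModels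

variable {d : ℕ}

/-! ### Raising a current from `0` to `2` on a set of edges -/

section Raise

variable {V : Type*} [Fintype V] [DecidableEq V] {G : SimpleGraph V} [DecidableRel G.Adj]

/-- The current raised to `2` on the edges of `S` (used where the current vanishes on `S`). [cite: AizenmanDuminilCopinSidoraviciusCMP2015, proof of Lemma 2.6] -/
def Current.raiseTwo (S : Finset G.edgeFinset) (n : Current G) : Current G :=
  fun e => if e ∈ S then 2 else n e

/-- Value of the raised current. [folklore] -/
@[simp] theorem Current.raiseTwo_apply (S : Finset G.edgeFinset) (n : Current G) (e : G.edgeFinset) :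
    n.raiseTwo S e = if e ∈ S then 2 else n e := rfl

/-- **Weight**: if `n` vanishes on `S`, raising it to `2` there multiplies the weight by
`(β²/2)^{|S|}` ("`∏ (βJ_{x,y})²/2`" in the proof of ADS15 Lemma 2.6). [cite: AizenmanDuminilCopinSidoraviciusCMP2015, proof of Lemma 2.6] -/
theorem Current.weight_raiseTwo (S : Finset G.edgeFinset) {n : Current G} (hn : ∀ e ∈ S, n e = 0)
    (β : ℝ) : (n.raiseTwo S).weight β = (β ^ 2 / 2) ^ S.card * n.weight β := by
  classical
  unfold Current.weight
  rw [← Finset.prod_mul_prod_compl S, ← Finset.prod_mul_prod_compl S (f := fun e => β ^ n e / _)]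
  have h1 : ∏ e ∈ S, β ^ (n.raiseTwo S e) / ((n.raiseTwo S e).factorial : ℝ) = (β ^ 2 / 2) ^ S.card := by
    rw [Finset.prod_congr rfl fun e he => by rw [Current.raiseTwo_apply, if_pos he], Finset.prod_const]
    norm_num
  have h2 : ∏ e ∈ S, β ^ (n e) / ((n e).factorial : ℝ) = 1 :=
    Finset.prod_eq_one fun e he => by rw [hn e he]; simp
  have h3 : ∏ e ∈ Sᶜ, β ^ (n.raiseTwo S e) / ((n.raiseTwo S e).factorial : ℝ) =
      ∏ e ∈ Sᶜ, β ^ (n e) / ((n e).factorial : ℝ) :=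
    Finset.prod_congr rfl fun e he => by
      rw [Current.raiseTwo_apply, if_neg (Finset.mem_compl.1 he)]
  rw [h1, h2, h3, one_mul]

/-- **Degrees** change by even amounts: `deg_{n'} x = deg_n x + 2 #{e ∈ S : x ∈ e}` when `n`
vanishes on `S`. [folklore] -/
theorem Current.degree_raiseTwo (S : Finset G.edgeFinset) {n : Current G}
    (hn : ∀ e ∈ S, n e = 0) (x : V) :
    (n.raiseTwo S).degree x = n.degree x + 2 * (S.filter fun e : G.edgeFinset => x ∈ (e : Sym2 V)).card := by
  classical
  unfold Current.degree
  have hsplit : ∀ e : G.edgeFinset, (if x ∈ (e : Sym2 V) then n.raiseTwo S e else 0) =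
      (if x ∈ (e : Sym2 V) then n e else 0) + (if e ∈ S ∧ x ∈ (e : Sym2 V) then 2 else 0) := by
    intro e
    by_cases he : e ∈ S <;> by_cases hx : x ∈ (e : Sym2 V) <;> simp [he, hx, hn _]
  simp_rw [hsplit]
  rw [Finset.sum_add_distrib, Finset.card_eq_sum_ones, Finset.mul_sum, Finset.sum_filter]
  congr 1
  rw [← Finset.sum_subset (Finset.subset_univ S) (fun e _ he => by simp [he])]
  refine Finset.sum_congr rfl fun e he => ?_
  by_cases hx : x ∈ (e : Sym2 V) <;> simp [he, hx]

/-- **Sources are unchanged** by raising a vanishing current to `2` on `S`. [cite: AizenmanDuminilCopinSidoraviciusCMP2015, proof of Lemma 2.6] -/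
theorem Current.sources_raiseTwo (S : Finset G.edgeFinset) {n : Current G}
    (hn : ∀ e ∈ S, n e = 0) : (n.raiseTwo S).sources = n.sources := by
  ext x
  rw [Current.mem_sources_iff, Current.mem_sources_iff, Current.degree_raiseTwo S hn x, Nat.odd_add]
  simp

/-- **Trace**: the trace of the raised current is the old trace together with the edges of `S`. [folklore] -/
theorem Current.traced_raiseTwo (S : Finset G.edgeFinset) (n : Current G) :
    (n.raiseTwo S).traced = n.traced ∪ ((fun e : G.edgeFinset => (e : Sym2 V)) '' ↑S) := by
  ext e
  constructor
  · rintro ⟨he, hpos⟩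
    rw [Current.raiseTwo_apply] at hpos
    by_cases hS : (⟨e, he⟩ : G.edgeFinset) ∈ S
    · exact Or.inr ⟨⟨e, he⟩, hS, rfl⟩
    · rw [if_neg hS] at hpos
      exact Or.inl ⟨he, hpos⟩
  · rintro (⟨he, hpos⟩ | ⟨e', he', rfl⟩)
    · refine ⟨he, ?_⟩
      rw [Current.raiseTwo_apply]
      split_ifs
      · norm_num
      · exact hpos
    · refine ⟨e'.2, ?_⟩
      rw [Current.raiseTwo_apply, if_pos (by simpa using he')]
      norm_num

/-- Recovering `n` from the raised current and `S`: `n e = if e ∈ S then 0 else n' e`. [folklore] -/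
theorem Current.eq_of_raiseTwo (S : Finset G.edgeFinset) {n : Current G} (hn : ∀ e ∈ S, n e = 0) :
    n = fun e => if e ∈ S then 0 else n.raiseTwo S e := by
  funext e
  by_cases he : e ∈ S
  · rw [if_pos he, hn e he]
  · rw [if_neg he, Current.raiseTwo_apply, if_neg he]

end Raise

/-! ### The insertion map on pairs of box currents -/

section Box

variable (d)

/-- The bonds of the plus box graph of `Λ_L` lying over the lattice bonds `F` and carrying no
current in the pair `p` — the bonds modified by the insertion map (ADS15, proof of Lemma 2.6:
"changing the value of the current `n₂` on edges `{x,y}` with `ω_{{x,y}} = 0` from `0` to `2`"). [cite: AizenmanDuminilCopinSidoraviciusCMP2015, proof of Lemma 2.6] -/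
def insertSet (L : ℕ) (F : Finset (Sym2 (Site d)))
    (p : Current (freeBoxGraph d L) × Current (plusBoxGraph d L)) :
    Finset (plusBoxGraph d L).edgeFinset := by
  classical
  exact Finset.univ.filter fun e => Sym2.map Subtype.val (e : Sym2 (BoxVertex d L)) ∈ F ∧
    (e : Sym2 (BoxVertex d L)) ∉ p.1.traced ∧ (e : Sym2 (BoxVertex d L)) ∉ p.2.traced

/-- **The insertion map `Φ_N`** of ADS15, proof of Lemma 2.6, on pairs (free current, plus current):
the plus current is raised from `0` to `2` on the bonds over `F` carrying no current. [cite: AizenmanDuminilCopinSidoraviciusCMP2015, proof of Lemma 2.6] -/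
def insertPair (L : ℕ) (F : Finset (Sym2 (Site d)))
    (p : Current (freeBoxGraph d L) × Current (plusBoxGraph d L)) :
    Current (freeBoxGraph d L) × Current (plusBoxGraph d L) :=
  (p.1, p.2.raiseTwo (insertSet d L F p))

variable {d}

/-- Membership in the modified set. [folklore] -/
theorem mem_insertSet_iff {L : ℕ} {F : Finset (Sym2 (Site d))}
    {p : Current (freeBoxGraph d L) × Current (plusBoxGraph d L)} {e : (plusBoxGraph d L).edgeFinset} :
    e ∈ insertSet d L F p ↔ Sym2.map Subtype.val (e : Sym2 (BoxVertex d L)) ∈ F ∧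
      (e : Sym2 (BoxVertex d L)) ∉ p.1.traced ∧ (e : Sym2 (BoxVertex d L)) ∉ p.2.traced := by
  classical
  simp [insertSet]

/-- The plus current vanishes on the modified set. [folklore] -/
theorem apply_eq_zero_of_mem_insertSet {L : ℕ} {F : Finset (Sym2 (Site d))}
    {p : Current (freeBoxGraph d L) × Current (plusBoxGraph d L)} {e : (plusBoxGraph d L).edgeFinset}
    (he : e ∈ insertSet d L F p) : p.2 e = 0 := by
  obtain ⟨-, -, h2⟩ := mem_insertSet_iff.1 he
  by_contra hne
  exact h2 ((Current.mem_traced_iff p.2 e).2 (Nat.pos_of_ne_zero hne))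

/-- The modified set has at most `|F|` elements (lifting bonds is injective). [folklore] -/
theorem card_insertSet_le {L : ℕ} (F : Finset (Sym2 (Site d)))
    (p : Current (freeBoxGraph d L) × Current (plusBoxGraph d L)) :
    (insertSet d L F p).card ≤ F.card := by
  classical
  refine Finset.card_le_card_of_injOn (fun e => Sym2.map Subtype.val (e : Sym2 (BoxVertex d L)))
    (fun e he => (mem_insertSet_iff.1 he).1) ?_
  intro e _ e' _ h
  exact Subtype.ext (Sym2.map.injective Subtype.val_injective h)

/-- **The pair weight under insertion**: `w(Φ p) = (β²/2)^{#modified} · w(p)` — the sources of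
both currents are unchanged, so the constraint `∂n₁ = ∅, ∂n₂ ⊆ ∂Λ` is preserved. [cite: AizenmanDuminilCopinSidoraviciusCMP2015, proof of Lemma 2.6] -/
theorem adsPairWeight_insertPair (L : ℕ) (β : ℝ) (F : Finset (Sym2 (Site d)))
    (p : Current (freeBoxGraph d L) × Current (plusBoxGraph d L)) :
    adsPairWeight d L β (insertPair d L F p) =
      (β ^ 2 / 2) ^ (insertSet d L F p).card * adsPairWeight d L β p := by
  classical
  have h0 : ∀ e ∈ insertSet d L F p, p.2 e = 0 := fun e he => apply_eq_zero_of_mem_insertSet he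
  unfold adsPairWeight insertPair
  simp only
  rw [Current.sources_raiseTwo _ h0, Current.weight_raiseTwo _ h0]
  split_ifs <;> ring

/-- Hence `w(p) ≤ max(1, 2/β²)^{|F|} · w(Φ p)` for `β > 0`. [cite: AizenmanDuminilCopinSidoraviciusCMP2015, proof of Lemma 2.6] -/
theorem adsPairWeight_le_mul_insertPair (L : ℕ) {β : ℝ} (hβ : 0 < β) (F : Finset (Sym2 (Site d)))
    (p : Current (freeBoxGraph d L) × Current (plusBoxGraph d L)) :
    adsPairWeight d L β p ≤ max 1 (2 / β ^ 2) ^ F.card * adsPairWeight d L β (insertPair d L F p) := by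
  rw [adsPairWeight_insertPair]
  set k := (insertSet d L F p).card with hk
  have hkF : k ≤ F.card := card_insertSet_le F p
  have hw : 0 ≤ adsPairWeight d L β p := adsPairWeight_nonneg d L hβ.le p
  have hq : 0 < β ^ 2 / 2 := by positivity
  have hM : 1 ≤ max 1 (2 / β ^ 2) := le_max_left _ _
  -- `max(1,2/β²)^{|F|} (β²/2)^k ≥ max(1,2/β²)^k (β²/2)^k ≥ 1`
  have key : 1 ≤ max 1 (2 / β ^ 2) ^ F.card * (β ^ 2 / 2) ^ k := by
    calc (1 : ℝ) = 1 ^ k := (one_pow k).symm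
      _ ≤ (max 1 (2 / β ^ 2) * (β ^ 2 / 2)) ^ k := by
          refine pow_le_pow_left₀ zero_le_one ?_ k
          calc (1 : ℝ) = (2 / β ^ 2) * (β ^ 2 / 2) := by field_simp
            _ ≤ max 1 (2 / β ^ 2) * (β ^ 2 / 2) :=
                mul_le_mul_of_nonneg_right (le_max_right _ _) hq.le
      _ = max 1 (2 / β ^ 2) ^ k * (β ^ 2 / 2) ^ k := mul_pow _ _ _
      _ ≤ max 1 (2 / β ^ 2) ^ F.card * (β ^ 2 / 2) ^ k :=
          mul_le_mul_of_nonneg_right (pow_le_pow_right₀ hM hkF) (pow_nonneg hq.le _)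
  calc adsPairWeight d L β p = 1 * adsPairWeight d L β p := (one_mul _).symm
    _ ≤ (max 1 (2 / β ^ 2) ^ F.card * (β ^ 2 / 2) ^ k) * adsPairWeight d L β p :=
        mul_le_mul_of_nonneg_right key hw
    _ = max 1 (2 / β ^ 2) ^ F.card * ((β ^ 2 / 2) ^ k * adsPairWeight d L β p) := by ring

/-- Every bond of `Λ_N`, `N ≤ L`, is the lift of a bond of the plus box graph of `Λ_L`. [folklore] -/
theorem exists_plusBoxEdge_of_mem_edgesIn {L N : ℕ} (hNL : N ≤ L) {e : Sym2 (Site d)}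
    (he : e ∈ edgesIn (zdGraph d) (box d N)) :
    ∃ e' : (plusBoxGraph d L).edgeFinset, Sym2.map Subtype.val (e' : Sym2 (BoxVertex d L)) = e := by
  rw [mem_edgesIn_iff] at he
  obtain ⟨hadj, hbox⟩ := he
  induction e using Sym2.ind with
  | _ a b =>
    have ha : a ∈ box d N := hbox a (Sym2.mem_mk_left a b)
    have hb : b ∈ box d N := hbox b (Sym2.mem_mk_right a b)
    have haL : a ∈ box d (L + 1) := box_mono d (by omega) ha
    have hbL : b ∈ box d (L + 1) := box_mono d (by omega) hb
    have hadj' : (plusBoxGraph d L).Adj ⟨a, haL⟩ ⟨b, hbL⟩ :=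
      ⟨(SimpleGraph.mem_edgeSet _).1 hadj, Or.inl (box_mono d hNL ha)⟩
    exact ⟨⟨s(⟨a, haL⟩, ⟨b, hbL⟩), SimpleGraph.mem_edgeFinset.2 hadj'⟩, by simp⟩

/-- **The trace under insertion**: if every bond of `F` lifts to the plus box graph (e.g.
`F = E(Λ_N)`, `N ≤ L`), lifting the traces of `Φ p` gives the lifted traces of `p` together with
`F` ("the set `Φ_N(Ω₂)` is obtained from `Ω₂` by changing the value of the current `n₂` on edges
`{x,y}` with `ω_{{x,y}} = 0` from `0` to `2`", so that the new trace is `ω ∪ E_N`). [cite: AizenmanDuminilCopinSidoraviciusCMP2015, proof of Lemma 2.6] -/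
theorem liftBonds_insertPair {L : ℕ} {F : Finset (Sym2 (Site d))}
    (hF : ∀ e ∈ F, ∃ e' : (plusBoxGraph d L).edgeFinset, Sym2.map Subtype.val (e' : Sym2 (BoxVertex d L)) = e)
    (p : Current (freeBoxGraph d L) × Current (plusBoxGraph d L)) :
    liftBonds d L ((insertPair d L F p).1.traced ∪ (insertPair d L F p).2.traced) =
      liftBonds d L (p.1.traced ∪ p.2.traced) ∪ ↑F := by
  have h1 : (insertPair d L F p).1 = p.1 := by simp only [insertPair]
  have h2 : (insertPair d L F p).2 = p.2.raiseTwo (insertSet d L F p) := by simp only [insertPair]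
  rw [h1, h2, Current.traced_raiseTwo, ← Set.union_assoc, liftBonds, liftBonds, Set.image_union]
  apply Set.eq_of_subset_of_subset
  · refine Set.union_subset_union_right _ ?_
    rintro e ⟨e', ⟨e'', he'', rfl⟩, rfl⟩
    exact (mem_insertSet_iff.1 he'').1
  · refine Set.union_subset Set.subset_union_left ?_
    intro e he
    obtain ⟨e', hmap⟩ := hF e he
    by_cases htr : (e' : Sym2 (BoxVertex d L)) ∈ p.1.traced ∪ p.2.traced
    · exact Or.inl ⟨_, htr, hmap⟩
    · refine Or.inr ⟨(e' : Sym2 (BoxVertex d L)), ⟨e', ?_, rfl⟩, hmap⟩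
      rw [Finset.mem_coe, mem_insertSet_iff, hmap]
      exact ⟨he, fun h => htr (Or.inl h), fun h => htr (Or.inr h)⟩

/-- **The insertion map is at most `2^{|F|}`-to-one**: `p ↦ (Φ p, modified set of p)` is injective
(ADS15, proof of Lemma 2.6: "the number of pre-images of each configuration is smaller than `2` to
the power the number of pairs of points in `Λ_N` (since one has to decide whether edges of `Λ_N`
were open or closed before the transformation)"). [cite: AizenmanDuminilCopinSidoraviciusCMP2015, proof of Lemma 2.6] -/
theorem insertPair_injective (L : ℕ) (F : Finset (Sym2 (Site d))) :
    Function.Injective fun p : Current (freeBoxGraph d L) × Current (plusBoxGraph d L) =>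
      (insertPair d L F p, insertSet d L F p) := by
  intro p q h
  simp only [Prod.mk.injEq, insertPair] at h
  obtain ⟨⟨h1, h2⟩, hS⟩ := h
  have hp : p.2 = fun e => if e ∈ insertSet d L F p then 0 else p.2.raiseTwo (insertSet d L F p) e :=
    Current.eq_of_raiseTwo (insertSet d L F p) fun e he => apply_eq_zero_of_mem_insertSet he
  have hq : q.2 = fun e => if e ∈ insertSet d L F q then 0 else q.2.raiseTwo (insertSet d L F q) e :=
    Current.eq_of_raiseTwo (insertSet d L F q) fun e he => apply_eq_zero_of_mem_insertSet he
  refine Prod.ext h1 ?_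
  rw [hp, hq, h2, hS]

/-! ### The bound on the law -/

/-- The double-current law of an event as a sum over pairs of currents. [cite: AizenmanDuminilCopinSidoraviciusCMP2015, §3.1, eq. (3.1)] -/
theorem adsDoubleCurrentLaw_apply (L : ℕ) (β : ℝ) (s : Set (Percolation.BondConfig (Site d))) (hs : MeasurableSet s) :
    adsDoubleCurrentLaw d L β s =
      ∑' p : Current (freeBoxGraph d L) × Current (plusBoxGraph d L),
        ENNReal.ofReal (adsPairWeight d L β p / adsPairNorm d L β) *
          s.indicator 1 (liftBonds d L (p.1.traced ∪ p.2.traced)) := by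
  rw [adsDoubleCurrentLaw, Measure.sum_apply_of_countable]
  refine tsum_congr fun p => ?_
  rw [Measure.smul_apply, smul_eq_mul, Measure.dirac_apply' _ hs]

/-- **ADS15 Lemma 2.6 in finite volume, uniformly in the volume** (box insertion tolerance of the
box double currents): for `β > 0` and every `N` there is a constant `c ∈ (0, ∞)` (namely
`(2 max(1, 2/β²))^{-|E(Λ_N)|}`) such that for all `L ≥ N` and every measurable event `E`,
`c · ℙ_{Λ_L,β}{ω : ω ∪ E(Λ_N) ∈ E} ≤ ℙ_{Λ_L,β}(E)`. [cite: AizenmanDuminilCopinSidoraviciusCMP2015, Lemma 2.6 and its proof] -/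
theorem adsDoubleCurrentLaw_box_insertion {β : ℝ} (hβ : 0 < β) (N : ℕ) :
    ∃ c : ℝ≥0∞, c ≠ 0 ∧ c ≠ ⊤ ∧ ∀ L : ℕ, N ≤ L → ∀ E : Set (Percolation.BondConfig (Site d)), MeasurableSet E →
      c * adsDoubleCurrentLaw d L β
          ((· ∪ (↑(edgesIn (zdGraph d) (box d N)) : Set (Sym2 (Site d)))) ⁻¹' E) ≤
        adsDoubleCurrentLaw d L β E := by
  classical
  set F := edgesIn (zdGraph d) (box d N) with hF
  set M : ℝ := max 1 (2 / β ^ 2) ^ F.card with hM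
  have hM1 : 1 ≤ M := one_le_pow₀ (le_max_left _ _)
  set K : ℝ≥0∞ := ENNReal.ofReal M * (2 : ℝ≥0∞) ^ F.card with hK
  have hK0 : K ≠ 0 := by
    refine mul_ne_zero ?_ (pow_ne_zero _ two_ne_zero)
    rw [ENNReal.ofReal_ne_zero_iff]; linarith
  have hKtop : K ≠ ⊤ := ENNReal.mul_ne_top ENNReal.ofReal_ne_top (ENNReal.pow_ne_top ENNReal.ofNat_ne_top)
  refine ⟨K⁻¹, ENNReal.inv_ne_zero.2 hKtop, ENNReal.inv_ne_top.2 hK0, fun L hNL E hE => ?_⟩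
  -- it suffices to bound `μ(Φ̂⁻¹ E) ≤ K μ(E)`
  suffices h : adsDoubleCurrentLaw d L β ((· ∪ (↑F : Set (Sym2 (Site d)))) ⁻¹' E) ≤
      K * adsDoubleCurrentLaw d L β E by
    calc K⁻¹ * adsDoubleCurrentLaw d L β ((· ∪ (↑F : Set (Sym2 (Site d)))) ⁻¹' E)
        ≤ K⁻¹ * (K * adsDoubleCurrentLaw d L β E) := mul_le_mul' le_rfl h
      _ = adsDoubleCurrentLaw d L β E := by rw [← mul_assoc, ENNReal.inv_mul_cancel hK0 hKtop, one_mul]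
  have hEpre : MeasurableSet ((· ∪ (↑F : Set (Sym2 (Site d)))) ⁻¹' E) := by
    have hmeas : Measurable fun ω : Percolation.BondConfig (Site d) => ω ∪ (↑F : Set (Sym2 (Site d))) :=
      measurable_set_iff.2 fun e => (measurable_set_mem e).or measurable_const
    exact hmeas hE
  rw [adsDoubleCurrentLaw_apply L β _ hEpre, adsDoubleCurrentLaw_apply L β E hE]
  -- abbreviations
  set Z := adsPairNorm d L β with hZ
  have hZpos : 0 < Z := adsPairNorm_pos d L hβ.le
  set c : Current (freeBoxGraph d L) × Current (plusBoxGraph d L) → ℝ≥0∞ := fun p =>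
    ENNReal.ofReal (adsPairWeight d L β p / Z) with hc
  set G : Current (freeBoxGraph d L) × Current (plusBoxGraph d L) → ℝ≥0∞ := fun q =>
    c q * E.indicator 1 (liftBonds d L (q.1.traced ∪ q.2.traced)) with hG
  -- Step 1: pointwise, `c(p) 𝟙[lift p ∪ F ∈ E] ≤ ofReal M · G(Φ p)`
  have hstep1 : ∀ p, c p * ((· ∪ (↑F : Set (Sym2 (Site d)))) ⁻¹' E).indicator 1
      (liftBonds d L (p.1.traced ∪ p.2.traced)) ≤ ENNReal.ofReal M * G (insertPair d L F p) := by
    intro p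
    have hlift : liftBonds d L ((insertPair d L F p).1.traced ∪ (insertPair d L F p).2.traced) =
        liftBonds d L (p.1.traced ∪ p.2.traced) ∪ ↑F :=
      liftBonds_insertPair (fun e he => exists_plusBoxEdge_of_mem_edgesIn hNL he) p
    have hcp : c p ≤ ENNReal.ofReal M * c (insertPair d L F p) := by
      rw [hc]
      simp only
      rw [← ENNReal.ofReal_mul (by linarith)]
      refine ENNReal.ofReal_le_ofReal ?_
      rw [← mul_div_assoc]
      exact div_le_div_of_nonneg_right (adsPairWeight_le_mul_insertPair L hβ F p) hZpos.le
    have hind : ((· ∪ (↑F : Set (Sym2 (Site d)))) ⁻¹' E).indicator (1 : Percolation.BondConfig (Site d) → ℝ≥0∞)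
        (liftBonds d L (p.1.traced ∪ p.2.traced)) =
        E.indicator 1 (liftBonds d L ((insertPair d L F p).1.traced ∪ (insertPair d L F p).2.traced)) := by
      rw [hlift]
      simp only [Set.indicator_apply, Set.mem_preimage, Pi.one_apply]
    rw [hind, hG]
    simp only
    rw [← mul_assoc]
    exact mul_le_mul' hcp le_rfl
  -- Step 2: `∑_p G(Φ p) ≤ 2^{|F|} ∑_q G(q)` (fibres of `Φ` have at most `2^{|F|}` elements)
  set Ft : Finset (plusBoxGraph d L).edgeFinset :=
    Finset.univ.filter fun e => Sym2.map Subtype.val (e : Sym2 (BoxVertex d L)) ∈ F with hFt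
  have hSFt : ∀ p, insertSet d L F p ⊆ Ft := fun p e he => by
    rw [hFt, Finset.mem_filter]
    exact ⟨Finset.mem_univ _, (mem_insertSet_iff.1 he).1⟩
  have hFtcard : Ft.card ≤ F.card := by
    refine Finset.card_le_card_of_injOn (fun e => Sym2.map Subtype.val (e : Sym2 (BoxVertex d L)))
      (fun e he => (Finset.mem_filter.1 he).2) ?_
    intro e _ e' _ h
    exact Subtype.ext (Sym2.map.injective Subtype.val_injective h)
  have hstep2 : ∑' p, G (insertPair d L F p) ≤ (2 : ℝ≥0∞) ^ F.card * ∑' q, G q := by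
    set H : (Current (freeBoxGraph d L) × Current (plusBoxGraph d L)) ×
        Finset (plusBoxGraph d L).edgeFinset → ℝ≥0∞ := fun qs =>
      G qs.1 * (if qs.2 ⊆ Ft then 1 else 0) with hH
    have h1 : ∑' p, G (insertPair d L F p) = ∑' p, H (insertPair d L F p, insertSet d L F p) := by
      refine tsum_congr fun p => ?_
      rw [hH]; simp only
      rw [if_pos (hSFt p), mul_one]
    rw [h1]
    refine (ENNReal.tsum_comp_le_tsum_of_injective (insertPair_injective L F) H).trans ?_
    rw [ENNReal.tsum_prod']
    have h2 : ∀ q, ∑' S : Finset (plusBoxGraph d L).edgeFinset, H (q, S) = G q * (2 : ℝ≥0∞) ^ Ft.card := by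
      intro q
      rw [hH]; simp only
      rw [ENNReal.tsum_mul_left]
      congr 1
      rw [tsum_eq_sum (s := Ft.powerset) (fun S hS => by
        rw [if_neg (fun h => hS (Finset.mem_powerset.2 h))])]
      rw [Finset.sum_congr rfl fun S hS => by rw [if_pos (Finset.mem_powerset.1 hS)],
        Finset.sum_const, Finset.card_powerset, nsmul_eq_mul, mul_one]
      push_cast; rfl
    simp_rw [h2]
    rw [ENNReal.tsum_mul_right, mul_comm]
    exact mul_le_mul' (pow_le_pow_right₀ (by norm_num) hFtcard) le_rfl
  -- Step 3: combine
  calc ∑' p, c p * ((· ∪ (↑F : Set (Sym2 (Site d)))) ⁻¹' E).indicator 1 (liftBonds d L (p.1.traced ∪ p.2.traced))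
      ≤ ∑' p, ENNReal.ofReal M * G (insertPair d L F p) := ENNReal.tsum_le_tsum hstep1
    _ = ENNReal.ofReal M * ∑' p, G (insertPair d L F p) := ENNReal.tsum_mul_left
    _ ≤ ENNReal.ofReal M * ((2 : ℝ≥0∞) ^ F.card * ∑' q, G q) := mul_le_mul' le_rfl hstep2
    _ = K * ∑' q, G q := by rw [hK, mul_assoc]

end Box

end Literature.Probability.LatticeModels
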